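import Summits.ResolutionOfSingularities.ResolutionOfSingularities.Theorems.FrobeniusClosingSteerFreeStepTelescope
import Summits.ResolutionOfSingularities.ResolutionOfSingularities.Theorems.FrobeniusClosingSteerFreeChainCoordinates
import Summits.ResolutionOfSingularities.ResolutionOfSingularities.Theorems.FrobeniusClosingSteerCompletionRecognition
import Summits.ResolutionOfSingularities.ResolutionOfSingularities.Theorems.FrobeniusClosingSteerJacobianLengthTransport
import Summits.ResolutionOfSingularities.ResolutionOfSingularities.Theorems.FrobeniusClosingSteerChartRealisability
import Summits.ResolutionOfSingularities.ResolutionOfSingularities.Theorems.FrobeniusClosingSteerIsolatedJacobianColength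
import Summits.ResolutionOfSingularities.ResolutionOfSingularities.Theorems.FrobeniusClosingSteerAdaptedCohenFrame
import Literature.AlgebraicGeometry.Resolution.RegularSystemOfParameters
import Mathlib.Algebra.CharP.Subring
import HarnessLib

/-!
# Crux `Steer` (stmt-ResolutionOfSingularities-16345), chain W4.1, hG3 / G-geom WORK-DIRECT: Lemma F♭ PART 3b(D) — THE ASSEMBLY:
# no eternal ALL-FREE chain of RATIONAL quadratic transforms carrying an isolated `2`-radicand with perfect residue field

OURS (campaign `res-hironaka`, rung L ★L-G4, slot W4.1; seat res-L0-w41-stub-2 g6, res-L0-w41-plan-1 RULINGs 136a/152a/152c/165b; spec =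
res-L0-w41-tri-2 `gpd/audit_GPERF_DIRECT.md` §4 CLAIM F♭ + §5; replaces the role of no printed item; NOT a statement of the manuscript under review
[claim: Hironaka2017, status: under-review]; AI-produced, weaker than expert review). Theses-free, definition-free. With res-D-pv-007's Lemma S
(`NoTangentialStepPerfect`: every step of a constant-order isolated chain is free) this is the rational case of the G-perf(3) word
`NoEternalConstOrderIsolatedChainPerfect 2 3 (2e)`.

THE BRIDGE (one chain, every length `M ≥ 1`): `FreeChain.exists_coordinates` (p540237; `𝔪₀ = (u, ỹ₁, ỹ₂)`, `𝔪_M = (u, w₁, w₂)`, `ỹᵢ = u^M wᵢ`) and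
`FreeChain.exists_telescope` (`f₀ = Ψ² + u^(2eM) E² f_M` in `S M`) · Cohen frame of `Ŝ_M` ADAPTED to `(u, w₁, w₂)` (res-D-pv-007 p540019
`NoSatelliteStep.exists_adapted_cohenFrame`) · realisability `ChartRealisability.map_mem_monoidPowerSeries` (res-D-pv-007 p537513: `S 0 ↪ Ŝ_M ≅ K⟦X⟧` lands in
`K⟦x, x^M y, x^M z⟧`) · inversion of the free substitution `θ_M` (`substGeneratorsOnto`, injective by `ChartMonomialSubst.substGenerators_injective`)
⟹ a READING `ψ : S 0 → K⟦X⟧` with `θ_M ∘ ψ = frame ∘ incl`, `ψ(u, ỹ₁, ỹ₂) = (X₀, X₁, X₂)`, residue-surjective · `CompletionRecognition.exists_ringEquiv` (p541490)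
⟹ `ψ̂ : Ŝ₀ ≃+* K⟦X⟧` · PART 3a `G3Perf.milnorLength_ge_of_substGenerators_eq` (p539166) ⟹ `M − 1 ≤ τ(ψ f₀)` · res-L0-w41-stub-3's K1
`IsolatedColength.length_quotient_span_derivation_lt_top_of_isolated` ⟹ `τ < ∞` · `JacobianLength.length_quotient_jacobian_eq_of_ringEquiv` (p542444) ⟹
`τ(ψ f₀) = ℓ(Ŝ₀ ⧸ 𝒥_abs(f̂₀))` is the SAME number for every `M`.

* `FreeChainBound.constantCoeff_substGenerators` — the free substitution keeps constant terms;
* `FreeChainBound.exists_reading` — the reading `ψ` (abstract: any local `S → T` with the coordinate/rationality data and a frame of `T̂`);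
* `FreeChainBound.milnorLength_completion_ge_of_reading` — a reading with `θ_M (ψ f₀) = Ψ² + x^(M·2e)·G` forces `M − 1 ≤ ℓ(Ŝ ⧸ 𝒥_abs(f̂₀)) < ∞`;
* `FreeChainBound.exists_free_chain_data` — the chain-level data after `M` rational free steps (coordinates, telescope, lifts);
* `FreeChainBound.milnorLength_completion_ge` — **after `M` rational free steps, `M − 1 ≤ ℓ(Ŝ₀ ⧸ 𝒥_abs(f̂₀)) < ∞`**;
* `FreeChainBound.not_eternal_free_rational_chain` — **Lemma F**: an eternal all-free rational chain is impossible. [folklore]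
-/

noncomputable section

set_option linter.dupNamespace false

open IsLocalRing MvPowerSeries
open Literature.AlgebraicGeometry.Resolution Literature.RingTheory.MvPowerSeries Literature.RingTheory.MvPowerSeries.monoidPowerSeries
open Summit.ResolutionOfSingularities.ResolutionOfSingularities.Theorems.SwitchingDichotomy
open Summit.ResolutionOfSingularities.ResolutionOfSingularities.Theorems.SwitchingDichotomy.ChartMonomialSubst

namespace Summit.ResolutionOfSingularities.ResolutionOfSingularities.Theorems.SwitchingDichotomy.FreeChainBound

/-! ## The free substitution keeps constant terms -/

/-- The substitution `θ` along an injective exponent map does not change the constant term. [folklore] -/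
theorem constantCoeff_substGenerators {σ R ι : Type*} [CommRing R] [Finite ι] (g : ι → (σ →₀ ℕ)) (hg0 : ∀ i, g i ≠ 0)
    (hinj : Function.Injective (expSum g)) (F : MvPowerSeries ι R) :
    constantCoeff (substGenerators (R := R) g hg0 F) = constantCoeff F := by
  rw [← coeff_zero_eq_constantCoeff_apply, ← coeff_zero_eq_constantCoeff_apply, ← expSum_zero g,
    coeff_substGenerators_expSum g hg0 hinj F 0]

/-! ## The reading `ψ : S → K⟦X⟧` (abstract two-ring form) -/

/-- **The reading of `S` in the stage-`M` coordinates.** Let `φ : S → T` be a ring hom of local rings, `S` with perfect residue field of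
characteristic `2`, `K` a field of characteristic `2` and `frame : T̂ ≃+* K⟦X₀, X₁, X₂⟧`. Suppose `𝔪_S = (u, ỹ₀, ỹ₁)`, `frame (φ u) = X₀`,
`frame (wᵢ) = X_{i+1}`, `φ ỹᵢ = φ u^M · wᵢ` (free-chain coordinates), every element of `T` is congruent mod `𝔪_T` to an image of `S` (rationality),
and the constant term of `frame` vanishes on `𝔪_T` and takes every value. Then there is a ring hom `ψ : S → K⟦X⟧` with `θ_M (ψ s) = frame (φ s)` for all `s`
(`θ_M` = the free substitution `X₀ ↦ X₀, Xᵢ ↦ X₀^M Xᵢ`, so `S` is READ in the arc coordinates), `ψ (u, ỹ₀, ỹ₁) = (X₀, X₁, X₂)`, and `ψ` residue-surjective.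
(Realisability `ChartRealisability.map_mem_monoidPowerSeries` + inversion of `θ_M`.) [folklore] -/
theorem exists_reading {S T : Type} [CommRing S] [IsLocalRing S] [CommRing T] [IsLocalRing T] [IsNoetherianRing T]
    {K : Type} [Field K] [CharP K 2] (φ : S →+* T) (frame : AdicCompletion (maximalIdeal T) T ≃+* MvPowerSeries (Fin 3) K)
    (hperf : ∀ a : ResidueField S, ∃ b : ResidueField S, b ^ 2 = a) (M : ℕ) (u : S) (yt : Fin 2 → S) (wM : Fin 2 → T)
    (hgen0 : Ideal.span (Set.range (Fin.cons u yt : Fin 3 → S)) = maximalIdeal S)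
    (hfu : frame (algebraMap T _ (φ u)) = X 0) (hfw : ∀ i : Fin 2, frame (algebraMap T _ (wM i)) = X i.succ)
    (hrel : ∀ i, φ (yt i) = φ u ^ M * wM i)
    (hrat : ∀ t : T, ∃ s : S, t - φ s ∈ maximalIdeal T)
    (hfm : ∀ t ∈ maximalIdeal T, constantCoeff (frame (algebraMap T _ t)) = 0)
    (hfs : ∀ c : K, ∃ t : T, constantCoeff (frame (algebraMap T _ t)) = c) :
    ∃ ψ : S →+* MvPowerSeries (Fin 3) K,
      (∀ s, substGenerators (R := K) (fun i : Fin 3 => Finsupp.single i 1 + if i = 0 then 0 else M • Finsupp.single 0 1)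
        (chartExp_ne_zero 0 M) (ψ s) = frame (algebraMap T _ (φ s))) ∧
      (∀ i, ψ ((Fin.cons u yt : Fin 3 → S) i) = X i) ∧
      ∀ c : K, ∃ s : S, constantCoeff (ψ s) = c := by
  classical
  haveI : Fact (Nat.Prime 2) := ⟨Nat.prime_two⟩
  -- the composite reading `ι = frame ∘ (T → T̂) ∘ φ`
  let ι : S →+* MvPowerSeries (Fin 3) K := (frame.toRingHom.comp (algebraMap T (AdicCompletion (maximalIdeal T) T))).comp φ
  have hιdef : ∀ s, ι s = frame (algebraMap T _ (φ s)) := fun s => rfl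
  have hιu : ι u = X 0 := hfu
  have hιyt : ∀ i : Fin 2, ι (yt i) = X 0 ^ M * X i.succ := fun i => by
    rw [hιdef, hrel i, map_mul, map_pow, map_mul, map_pow, hfu, hfw i]
  -- the free chart at the persisting letter `0` with weight `M`
  let gch : Fin 3 → (Fin 3 →₀ ℕ) := fun i => Finsupp.single i 1 + if i = 0 then 0 else M • Finsupp.single 0 1
  set P : AddSubmonoid (Fin 3 →₀ ℕ) := AddSubmonoid.closure (Set.range gch) with hP
  have hPmem : ∀ i, gch i ∈ P := fun i => by
    rw [hP]; exact AddSubmonoid.subset_closure ⟨i, rfl⟩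
  have hgmem : ∀ i, monomial (gch i) (1 : K) ∈ monoidPowerSeries K P := fun i =>
    monoidPowerSeries.monomial_mem (hPmem i) (1 : K)
  have hg0 : monomial (gch 0) (1 : K) = X 0 := by
    change monomial (Finsupp.single 0 1 + if (0 : Fin 3) = 0 then 0 else M • Finsupp.single 0 1) (1 : K) = X 0
    rw [if_pos rfl, add_zero, ← X_def]
  have hgsucc : ∀ i : Fin 2, monomial (gch i.succ) (1 : K) = X 0 ^ M * X i.succ := by
    intro i
    change monomial (Finsupp.single i.succ 1 + if i.succ = 0 then 0 else M • Finsupp.single 0 1) (1 : K) = _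
    rw [if_neg (Fin.succ_ne_zero i), X_pow_eq, X_def, monomial_mul_monomial, one_mul, add_comm, Finsupp.smul_single, smul_eq_mul, mul_one]
  -- realisability on the generators `u, ỹ₀, ỹ₁`
  let G : Finset S := insert u (Finset.univ.image yt)
  have hGset : (G : Set S) = Set.range (Fin.cons u yt : Fin 3 → S) := by
    rw [Fin.range_cons]; ext s; simp [G]
  have hG : Ideal.span (G : Set S) = maximalIdeal S := by rw [hGset]; exact hgen0
  have hιP : ∀ s ∈ G, ι s ∈ monoidPowerSeries K P := by
    intro s hs
    rcases Finset.mem_insert.mp hs with rfl | hs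
    · rw [hιu, ← hg0]; exact hgmem 0
    · obtain ⟨i, -, rfl⟩ := Finset.mem_image.mp hs
      rw [hιyt i, ← hgsucc i]; exact hgmem i.succ
  have hι0 : ∀ s ∈ G, constantCoeff (ι s) = 0 := by
    intro s hs
    rcases Finset.mem_insert.mp hs with rfl | hs
    · rw [hιu, constantCoeff_X]
    · obtain ⟨i, -, rfl⟩ := Finset.mem_image.mp hs
      rw [hιyt i, map_mul, constantCoeff_X, mul_zero]
  have hreal : ∀ s : S, ι s ∈ monoidPowerSeries K P := fun s =>
    ChartRealisability.map_mem_monoidPowerSeries 2 ι P G hperf hG hιP hι0 s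
  -- inverting the free substitution
  have hgch0 : ∀ i, gch i ≠ 0 := chartExp_ne_zero 0 M
  have hinj : Function.Injective (expSum gch) := expSum_chart_injective 0 M
  let θon := substGeneratorsOnto (R := K) gch hgch0 (P := P) hP.symm
  have hθbij : Function.Bijective θon :=
    ⟨fun F₁ F₂ h => substGenerators_injective gch hgch0 hinj (congrArg Subtype.val h), substGeneratorsOnto_surjective gch hgch0 hP.symm⟩
  let θe : MvPowerSeries (Fin 3) K ≃+* monoidPowerSeries K P := RingEquiv.ofBijective θon hθbij
  let ι' : S →+* monoidPowerSeries K P := ι.codRestrict (monoidPowerSeries K P) hreal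
  let ψ : S →+* MvPowerSeries (Fin 3) K := θe.symm.toRingHom.comp ι'
  have hθψ : ∀ s : S, substGenerators (R := K) gch hgch0 (ψ s) = ι s := by
    intro s
    have h1 : θe (ψ s) = ι' s := θe.apply_symm_apply (ι' s)
    exact congrArg Subtype.val h1
  have hθX : ∀ i, substGenerators (R := K) gch hgch0 (X i) = monomial (gch i) 1 := fun i => by
    rw [substGenerators_apply, subst_X (hasSubst_monomial gch hgch0)]
  have hψu : ψ u = X 0 := substGenerators_injective gch hgch0 hinj (by rw [hθψ, hθX, hιu, hg0])
  have hψyt : ∀ i : Fin 2, ψ (yt i) = X i.succ := fun i =>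
    substGenerators_injective gch hgch0 hinj (by rw [hθψ, hθX, hιyt, hgsucc])
  refine ⟨ψ, fun s => hθψ s, fun i => ?_, fun c => ?_⟩
  · refine Fin.cases ?_ (fun i => ?_) i
    · rw [Fin.cons_zero]; exact hψu
    · rw [Fin.cons_succ]; exact hψyt i
  · -- residue surjectivity: constant terms are read through `θ_M`, `frame` and rationality
    obtain ⟨t, ht⟩ := hfs c
    obtain ⟨s, hs⟩ := hrat t
    refine ⟨s, ?_⟩
    have h1 : constantCoeff (ψ s) = constantCoeff (ι s) := by
      rw [← constantCoeff_substGenerators gch hgch0 hinj (ψ s), hθψ s]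
    have h2 : constantCoeff (frame (algebraMap T _ (t - φ s))) = 0 := hfm _ hs
    rw [map_sub, map_sub, map_sub, ht, sub_eq_zero] at h2
    rw [h1, hιdef, ← h2]

/-! ## From a reading to the fuel bound -/

/-- **A reading bounds the fuel.** Let `S` be a regular local EXCELLENT ring of characteristic `2`, `f₀ ∈ S` a radicand with ISOLATED torsor germ,
`K` a perfect field of characteristic `2`, and `ψ : S → K⟦X₀,X₁,X₂⟧` a ring hom sending a generating triple of `𝔪_S` to the variables, residue-surjective,
with `θ_M (ψ f₀) = Ψ² + X₀^(M·2e)·G` (`M ≥ 1`, `e ≥ 1`). Then `M − 1 ≤ ℓ(Ŝ ⧸ 𝒥_abs(f̂₀)) < ∞`. (Recognition `ψ̂ : Ŝ ≃+* K⟦X⟧`, PART 3a, K1, and the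
ring-iso invariance of the Jacobian colength.) [folklore] -/
theorem milnorLength_completion_ge_of_reading {S : Type} [CommRing S] [IsRegularLocalRing S] [CharP S 2] (hexc : IsExcellentRing S)
    {K : Type} [Field K] [CharP K 2] [PerfectField K] (ψ : S →+* MvPowerSeries (Fin 3) K) (g : Fin 3 → S)
    (hg : Ideal.span (Set.range g) = maximalIdeal S) (hψg : ∀ i, ψ (g i) = X i) (hres : ∀ c : K, ∃ s : S, constantCoeff (ψ s) = c)
    (f₀ : S)
    (hiso : ∀ (P : Ideal (AdjoinRoot ((Polynomial.X : Polynomial S) ^ 2 - Polynomial.C f₀))) [P.IsPrime],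
      (∃ Q : Ideal (AdjoinRoot ((Polynomial.X : Polynomial S) ^ 2 - Polynomial.C f₀)), Q.IsPrime ∧ P < Q) →
        IsRegularLocalRing (Localization.AtPrime P))
    {M e : ℕ} (hM : 1 ≤ M) (he : 1 ≤ e) {Ψ G : MvPowerSeries (Fin 3) K}
    (hlaw : substGenerators (R := K) (fun i : Fin 3 => Finsupp.single i 1 + if i = 0 then 0 else M • Finsupp.single 0 1)
      (chartExp_ne_zero 0 M) (ψ f₀) = Ψ ^ 2 + X 0 ^ (M * (2 * e)) * G) :
    ((M - 1 : ℕ) : ℕ∞) ≤ Module.length (AdicCompletion (maximalIdeal S) S)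
        (AdicCompletion (maximalIdeal S) S ⧸ Ideal.span (Set.range fun D : Derivation ℤ (AdicCompletion (maximalIdeal S) S)
          (AdicCompletion (maximalIdeal S) S) => D (algebraMap S (AdicCompletion (maximalIdeal S) S) f₀))) ∧
      Module.length (AdicCompletion (maximalIdeal S) S)
        (AdicCompletion (maximalIdeal S) S ⧸ Ideal.span (Set.range fun D : Derivation ℤ (AdicCompletion (maximalIdeal S) S)
          (AdicCompletion (maximalIdeal S) S) => D (algebraMap S (AdicCompletion (maximalIdeal S) S) f₀))) < ⊤ := by
  haveI : Fact (Nat.Prime 2) := ⟨Nat.prime_two⟩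
  obtain ⟨ê, hê⟩ := CompletionRecognition.exists_ringEquiv ψ g hg hψg hres
  have hge := G3Perf.milnorLength_ge_of_substGenerators_eq (show 2 ≤ 2 * e by omega) hM hlaw
  have hF : ê (algebraMap S (AdicCompletion (maximalIdeal S) S) f₀) = ψ f₀ := hê f₀
  have hfinK := IsolatedColength.length_quotient_span_derivation_lt_top_of_isolated 2 hexc f₀ hiso ê
  have htransport := JacobianLength.length_quotient_jacobian_eq_of_ringEquiv ê (algebraMap S (AdicCompletion (maximalIdeal S) S) f₀)
  rw [hF] at hfinK htransport
  rw [← span_derivation_int_apply_eq_span_pderiv 2 (ψ f₀)] at hge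
  -- the two `ℤ`-algebra structures on `K⟦X⟧` in play (`MvPowerSeries.instAlgebra` in the power-series lemmas, the generic `Ring.toIntAlgebra`
  -- in the transport lemma) have the same derivations
  have hrange : ∀ (i₁ i₂ : Algebra ℤ (MvPowerSeries (Fin 3) K)) (b : MvPowerSeries (Fin 3) K),
      (Set.range fun D : @Derivation ℤ (MvPowerSeries (Fin 3) K) (MvPowerSeries (Fin 3) K) _ _ _ i₁ _ _ => D b) =
        Set.range fun D : @Derivation ℤ (MvPowerSeries (Fin 3) K) (MvPowerSeries (Fin 3) K) _ _ _ i₂ _ _ => D b := by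
    intro i₁ i₂ b
    obtain rfl : i₁ = i₂ := Algebra.algebra_ext _ _ fun r => (eq_intCast _ r).trans (eq_intCast _ r).symm
    rfl
  have hK : Ideal.span (Set.range fun D : Derivation ℤ (MvPowerSeries (Fin 3) K) (MvPowerSeries (Fin 3) K) => D (ψ f₀)) =
      Ideal.span (Set.range fun D : @Derivation ℤ (MvPowerSeries (Fin 3) K) (MvPowerSeries (Fin 3) K) _ _ _
        (Ring.toIntAlgebra (MvPowerSeries (Fin 3) K)) _ _ => D (ψ f₀)) :=
    congrArg Ideal.span (hrange _ _ _)
  rw [hK] at hge hfinK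
  exact ⟨hge.trans htransport.le, htransport.symm.trans_lt hfinK⟩

/-! ## The chain-level data -/

universe u

variable {L : Type} [Field L] [CharP L 2]

/-- **Chain data after `M` rational free steps.** For an ℕ-chain of regular `3`-dimensional local subrings of `L`, consecutive quadratic transforms in
the charts of `x m`, ALL FREE with RATIONAL centres, and radicands with the law of exponent `2e`: there are `u, ỹ₀, ỹ₁ ∈ S 0`, `w₀, w₁, Ψ, E ∈ S M` with
`𝔪₀ = (u, ỹ₀, ỹ₁)`, `𝔪_M = (u, w₀, w₁)`, `ỹᵢ = u^M wᵢ`, `f 0 = Ψ² + u^(2eM) E² f M`, and every element of `S M` congruent mod `𝔪_M` to one of `S 0`.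
(`FreeChain.exists_generator_eq_span`, `span_excParam_eq_of_free`, `exists_coordinates`, `exists_telescope`, `exists_sub_mem_maximalIdeal_of_rational`.)
[folklore] -/
theorem exists_free_chain_data (e : ℕ) (S : ℕ → Subring L) [∀ m, IsLocalRing (S m)]
    (hle : ∀ m, S m ≤ S (m + 1)) (f g : ∀ m, S m) (x : ∀ m, S (m + 1))
    (hreg : ∀ m, IsRegularLocalRing (S m)) (hdim : ∀ m, ringKrullDim (S m) = (3 : ℕ))
    (hqt : ∀ m, IsQuadraticTransform (S m) (S (m + 1)))
    (hspan : ∀ m, (maximalIdeal (S m)).map (Subring.inclusion (hle m)) = Ideal.span {x m})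
    (hlaw : ∀ m, ((f (m + 1) : S (m + 1)) : L) * ((x m : S (m + 1)) : L) ^ (2 * e) = ((f m : S m) : L) - ((g m : S m) : L) ^ 2)
    (hfree : ∀ m, Ideal.span {Subring.inclusion (hle (m + 1)) (x m)} = Ideal.span {x (m + 1)})
    (hrat : ∀ m (z : S (m + 1)), ∃ s : S m, z - Subring.inclusion (hle m) s ∈ maximalIdeal (S (m + 1))) (M : ℕ) :
    ∃ (u : S 0) (yt : Fin 2 → S 0) (wM : Fin 2 → S M) (Ψ E : S M),
      Ideal.span (Set.range (Fin.cons u yt : Fin 3 → S 0)) = maximalIdeal (S 0) ∧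
      Ideal.span (Set.range (Fin.cons (Subring.inclusion (FreeChain.monotone S hle (Nat.zero_le M)) u) wM : Fin 3 → S M)) = maximalIdeal (S M) ∧
      (∀ i, Subring.inclusion (FreeChain.monotone S hle (Nat.zero_le M)) (yt i) =
        Subring.inclusion (FreeChain.monotone S hle (Nat.zero_le M)) u ^ M * wM i) ∧
      Subring.inclusion (FreeChain.monotone S hle (Nat.zero_le M)) (f 0) =
        Ψ ^ 2 + Subring.inclusion (FreeChain.monotone S hle (Nat.zero_le M)) u ^ (M * (2 * e)) * (E ^ 2 * f M) ∧
      ∀ z : S M, ∃ s : S 0, z - Subring.inclusion (FreeChain.monotone S hle (Nat.zero_le M)) s ∈ maximalIdeal (S M) := by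
  classical
  haveI : ∀ m, IsRegularLocalRing (S m) := hreg
  -- an rsop `v` of `S 0`, one of whose members generates `𝔪₀ · S 1 = (x 0)`
  have hfin0 : (maximalIdeal (S 0)).spanFinrank = 3 := by
    have h := IsRegularLocalRing.spanFinrank_maximalIdeal (R := S 0)
    rw [hdim 0] at h
    exact_mod_cast h
  obtain ⟨v₀, hv₀⟩ := exists_regularSystemOfParameters (R := S 0)
  let v : Fin 3 → S 0 := fun i => v₀ (Fin.cast hfin0.symm i)
  have hv : Ideal.span (Set.range v) = maximalIdeal (S 0) := by
    rw [← hv₀]; congr 1; ext s; constructor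
    · rintro ⟨i, rfl⟩; exact ⟨_, rfl⟩
    · rintro ⟨j, rfl⟩; exact ⟨Fin.cast hfin0 j, by simp [v]⟩
  obtain ⟨k, hk⟩ := FreeChain.exists_generator_eq_span (hle 0) v hv (x 0) (hspan 0)
  set u : S 0 := v k with hu
  let w : Fin 2 → S 0 := fun i => v (k.succAbove i)
  have hgen : Ideal.span (insert u (Set.range w)) = maximalIdeal (S 0) := by
    rw [← hv]; congr 1
    ext s; simp only [Set.mem_insert_iff, Set.mem_range, w, hu]
    constructor
    · rintro (rfl | ⟨i, rfl⟩); exacts [⟨k, rfl⟩, ⟨_, rfl⟩]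
    · rintro ⟨j, rfl⟩
      by_cases hj : j = k
      · exact Or.inl (by rw [hj])
      · obtain ⟨i, rfl⟩ := Fin.exists_succAbove_eq hj
        exact Or.inr ⟨i, rfl⟩
  -- persistence of `u`, coordinates, telescope, iterated rationality
  have hxu := FreeChain.span_excParam_eq_of_free S hle x u hk hfree
  have hmu : ∀ m, (maximalIdeal (S m)).map (Subring.inclusion (hle m)) =
      Ideal.span {Subring.inclusion (FreeChain.monotone S hle (Nat.zero_le (m + 1))) u} := fun m => (hspan m).trans (hxu m)
  obtain ⟨yt, wM, hgen0, hgenM, hrel⟩ := FreeChain.exists_coordinates S hle hqt u w hgen hmu hrat M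
  obtain ⟨Ψ, E, hΨ⟩ := FreeChain.exists_telescope S hle f g x u e hlaw hxu M
  have hdom : ∀ m, SubringDominates (S m) (S (m + 1)) := fun m => (hqt m).dominates
  have hrat0 := FreeChain.exists_sub_mem_maximalIdeal_of_rational S hle hdom hrat
  refine ⟨u, yt, wM, Ψ, E, ?_, ?_, fun i => Subtype.ext ?_, Subtype.ext ?_, hrat0 M⟩
  · rw [Fin.range_cons]; exact hgen0
  · rw [Fin.range_cons]; exact hgenM
  · rw [Subring.coe_inclusion, hrel i, Subring.coe_mul, Subring.coe_pow, Subring.coe_inclusion]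
  · simp only [Subring.coe_inclusion, Subring.coe_add, Subring.coe_mul, Subring.coe_pow]
    rw [hΨ]; ring

/-! ## The fuel bound along a rational free chain, and Lemma F -/

/-- **After `M ≥ 1` rational free steps the fuel is at least `M − 1`, and it is finite.** Let `S : ℕ → Subring L` be a chain of regular local rings of
dimension `3` (characteristic `2`, perfect residue fields, `S 0` excellent), consecutive quadratic transforms with `𝔪_m · S (m+1) = (x m)`, ALL FREE
(`(x m) = (x (m+1))` in `S (m+2)`) with RATIONAL centres (`hrat`), radicands with `f (m+1) · (x m)^(2e) = f m − (g m)²`, `e ≥ 1`, and `f 0` with isolated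
torsor germ. Then `M − 1 ≤ ℓ(Ŝ₀ ⧸ 𝒥_abs(f̂₀)) < ∞` for EVERY `M ≥ 1`. [folklore] -/
theorem milnorLength_completion_ge (e : ℕ) (he : 1 ≤ e) (S : ℕ → Subring L) [∀ m, IsLocalRing (S m)]
    (hle : ∀ m, S m ≤ S (m + 1)) (f g : ∀ m, S m) (x : ∀ m, S (m + 1))
    (hreg : ∀ m, IsRegularLocalRing (S m)) (hexc : IsExcellentRing (S 0)) (hdim : ∀ m, ringKrullDim (S m) = (3 : ℕ))
    (hqt : ∀ m, IsQuadraticTransform (S m) (S (m + 1)))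
    (hspan : ∀ m, (maximalIdeal (S m)).map (Subring.inclusion (hle m)) = Ideal.span {x m})
    (hlaw : ∀ m, ((f (m + 1) : S (m + 1)) : L) * ((x m : S (m + 1)) : L) ^ (2 * e) = ((f m : S m) : L) - ((g m : S m) : L) ^ 2)
    (hperf : ∀ m, PerfectField (ResidueField (S m)))
    (hiso : ∀ (P : Ideal (AdjoinRoot ((Polynomial.X : Polynomial (S 0)) ^ 2 - Polynomial.C (f 0)))) [P.IsPrime],
      (∃ Q : Ideal (AdjoinRoot ((Polynomial.X : Polynomial (S 0)) ^ 2 - Polynomial.C (f 0))), Q.IsPrime ∧ P < Q) →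
        IsRegularLocalRing (Localization.AtPrime P))
    (hfree : ∀ m, Ideal.span {Subring.inclusion (hle (m + 1)) (x m)} = Ideal.span {x (m + 1)})
    (hrat : ∀ m (z : S (m + 1)), ∃ s : S m, z - Subring.inclusion (hle m) s ∈ maximalIdeal (S (m + 1)))
    (M : ℕ) (hM : 1 ≤ M) :
    ((M - 1 : ℕ) : ℕ∞) ≤ Module.length (AdicCompletion (maximalIdeal (S 0)) (S 0))
        (AdicCompletion (maximalIdeal (S 0)) (S 0) ⧸ Ideal.span (Set.range fun D : Derivation ℤ (AdicCompletion (maximalIdeal (S 0)) (S 0))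
          (AdicCompletion (maximalIdeal (S 0)) (S 0)) => D (algebraMap (S 0) (AdicCompletion (maximalIdeal (S 0)) (S 0)) (f 0)))) ∧
      Module.length (AdicCompletion (maximalIdeal (S 0)) (S 0))
        (AdicCompletion (maximalIdeal (S 0)) (S 0) ⧸ Ideal.span (Set.range fun D : Derivation ℤ (AdicCompletion (maximalIdeal (S 0)) (S 0))
          (AdicCompletion (maximalIdeal (S 0)) (S 0)) => D (algebraMap (S 0) (AdicCompletion (maximalIdeal (S 0)) (S 0)) (f 0)))) < ⊤ := by
  classical
  haveI : Fact (Nat.Prime 2) := ⟨Nat.prime_two⟩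
  obtain ⟨u, yt, wM, Ψ, E, hgen0, hgenM, hrel, hΨ, hrat0⟩ :=
    exists_free_chain_data e S hle f g x hreg hdim hqt hspan hlaw hfree hrat M
  -- the frame of `Ŝ_M` adapted to `(u, w₀, w₁)`
  haveI hregM : IsRegularLocalRing (S M) := hreg M
  haveI hreg0 : IsRegularLocalRing (S 0) := hreg 0
  haveI : CharP (AdicCompletion (maximalIdeal (S M)) (S M)) 2 := RadicandCohenFrame.charP_adicCompletion 2 (S M)
  haveI hperfM : PerfectField (ResidueField (S M)) := hperf M
  haveI : CharP (ResidueField (AdicCompletion (maximalIdeal (S M)) (S M))) 2 := RadicandCohenFrame.charP_residueField 2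
  haveI : PerfectField (ResidueField (AdicCompletion (maximalIdeal (S M)) (S M))) := (IsolatedColength.exists_cohenIso_perfect 2 (S M)).1
  obtain ⟨frame, hframe_x, hframe_res⟩ := NoSatelliteStep.exists_adapted_cohenFrame 2 (hdim M) _ hgenM
  -- the reading `ψ : S 0 → K⟦X⟧`
  have hperf0 : ∀ a : ResidueField (S 0), ∃ b : ResidueField (S 0), b ^ 2 = a := by
    haveI := hperf 0
    haveI : CharP (ResidueField (S 0)) 2 := RadicandCohenFrame.charP_residueField 2
    haveI : ExpChar (ResidueField (S 0)) 2 := ExpChar.prime Nat.prime_two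
    intro a; obtain ⟨b, hb⟩ := surjective_frobenius (ResidueField (S 0)) 2 a; exact ⟨b, hb⟩
  have hfu := hframe_x 0
  rw [Fin.cons_zero] at hfu
  have hfw : ∀ i : Fin 2, frame (algebraMap (S M) _ (wM i)) = X i.succ := fun i => by
    have h := hframe_x i.succ
    rwa [Fin.cons_succ] at h
  have hfm : ∀ t ∈ maximalIdeal (S M), constantCoeff (frame (algebraMap (S M) _ t)) = 0 := fun t ht => by
    rw [hframe_res, residue_eq_zero_iff, AdicCompletion.maximalIdeal_eq_map]
    exact Ideal.mem_map_of_mem _ ht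
  have hfs : ∀ c : ResidueField (AdicCompletion (maximalIdeal (S M)) (S M)), ∃ t : S M, constantCoeff (frame (algebraMap (S M) _ t)) = c := by
    intro c
    obtain ⟨a, rfl⟩ := IsLocalRing.residue_surjective c
    obtain ⟨t, ht⟩ := CompletionRecognition.exists_sub_algebraMap_mem_pow (S := S M) a 1
    refine ⟨t, ?_⟩
    rw [pow_one] at ht
    rw [hframe_res, ← sub_eq_zero, ← RingHom.map_sub, residue_eq_zero_iff, ← neg_sub, neg_mem_iff]
    exact ht
  obtain ⟨ψ, hθψ, hψg, hres⟩ := exists_reading (Subring.inclusion (FreeChain.monotone S hle (Nat.zero_le M))) frame hperf0 M u yt wM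
    hgen0 hfu hfw hrel hrat0 hfm hfs
  -- the law read through `θ_M`
  have hlaw' := hθψ (f 0)
  rw [hΨ, map_add, map_pow, map_mul, map_pow, map_add, map_pow, map_mul, map_pow, hfu] at hlaw'
  exact milnorLength_completion_ge_of_reading hexc ψ _ hgen0 hψg hres (f 0) hiso hM he hlaw'

/-- **Lemma F (rational form): an eternal ALL-FREE chain of RATIONAL quadratic transforms carrying an isolated `2`-radicand (perfect residue fields,
dimension `3`, even exponent `2e ≥ 2`) does not exist.** By `milnorLength_completion_ge` at `M = 1` the fuel `N = ℓ(Ŝ₀ ⧸ 𝒥_abs(f̂₀))` is finite, and at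
`M = N + 2` it would be at least `N + 1`. (With res-D-pv-007's Lemma S — every step of a constant-order isolated chain is free — this is the rational
case of `NoEternalConstOrderIsolatedChainPerfect 2 3 (2e)`; res-L0-w41-tri-2 audit_GPERF_DIRECT §5.) [folklore] -/
theorem not_eternal_free_rational_chain (e : ℕ) (he : 1 ≤ e) (S : ℕ → Subring L) [∀ m, IsLocalRing (S m)]
    (hle : ∀ m, S m ≤ S (m + 1)) (f g : ∀ m, S m) (x : ∀ m, S (m + 1))
    (hreg : ∀ m, IsRegularLocalRing (S m)) (hexc : IsExcellentRing (S 0)) (hdim : ∀ m, ringKrullDim (S m) = (3 : ℕ))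
    (hqt : ∀ m, IsQuadraticTransform (S m) (S (m + 1)))
    (hspan : ∀ m, (maximalIdeal (S m)).map (Subring.inclusion (hle m)) = Ideal.span {x m})
    (hlaw : ∀ m, ((f (m + 1) : S (m + 1)) : L) * ((x m : S (m + 1)) : L) ^ (2 * e) = ((f m : S m) : L) - ((g m : S m) : L) ^ 2)
    (hperf : ∀ m, PerfectField (ResidueField (S m)))
    (hiso : ∀ (P : Ideal (AdjoinRoot ((Polynomial.X : Polynomial (S 0)) ^ 2 - Polynomial.C (f 0)))) [P.IsPrime],
      (∃ Q : Ideal (AdjoinRoot ((Polynomial.X : Polynomial (S 0)) ^ 2 - Polynomial.C (f 0))), Q.IsPrime ∧ P < Q) →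
        IsRegularLocalRing (Localization.AtPrime P))
    (hfree : ∀ m, Ideal.span {Subring.inclusion (hle (m + 1)) (x m)} = Ideal.span {x (m + 1)})
    (hrat : ∀ m (z : S (m + 1)), ∃ s : S m, z - Subring.inclusion (hle m) s ∈ maximalIdeal (S (m + 1))) : False := by
  obtain ⟨-, hfin⟩ := milnorLength_completion_ge e he S hle f g x hreg hexc hdim hqt hspan hlaw hperf hiso hfree hrat 1 le_rfl
  set N := (Module.length (AdicCompletion (maximalIdeal (S 0)) (S 0))
        (AdicCompletion (maximalIdeal (S 0)) (S 0) ⧸ Ideal.span (Set.range fun D : Derivation ℤ (AdicCompletion (maximalIdeal (S 0)) (S 0))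
          (AdicCompletion (maximalIdeal (S 0)) (S 0)) => D (algebraMap (S 0) (AdicCompletion (maximalIdeal (S 0)) (S 0)) (f 0))))).toNat with hN
  obtain ⟨hge, -⟩ := milnorLength_completion_ge e he S hle f g x hreg hexc hdim hqt hspan hlaw hperf hiso hfree hrat (N + 2) (by omega)
  rw [← ENat.coe_toNat hfin.ne, ← hN] at hge
  have := ENat.coe_le_coe.mp hge
  omega

end Summit.ResolutionOfSingularities.ResolutionOfSingularities.Theorems.SwitchingDichotomy.FreeChainBound

end
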